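import Summits.QuantumFields.YangMills.Theorems.BalabanUVNodesN18U3LettersOfLocalTermsPackage
import Summits.QuantumFields.YangMills.Theorems.BalabanUVNodesN18LocalStabilityRateOfTermwise

/-!
# BalabanUVNodes ∕ N18 (node U3's kernel objects) — THE TERM-DATA PACKAGE, TERMWISE EDITION: node U3's four letters of record from W1-20's law + PER-TERM data only (single-run
# analyticity with tails, the two-run sup bound through a common complexification, the per-term volume-independence rate) + ONE displayed piece of lattice GEOMETRY (the local domain
# matching of consecutive tori)
# (Track A, DAG node N18 = NE5 ∕ node U3's letters; key K3⁸ `SpineGivenEndpointR13SepCoPHV` = stmt-QuantumFields-27366; cell `pub-ymgap`, WIDTH SEAT `pub-ymgap-dag-n18-w2` g10,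
# FILE 5; `--kind proof --supports stmt-QuantumFields-27366 --as helper`, COUNT-NEUTRAL; THEOREMS ONLY, 0 `def`, 0 `sorry`)

WHY.  PART 1 (`…N18U3LettersOfLocalTermsPackage`) still displayed ONE sum-level row, the local stability rate (P2); FILE 4 (`…N18LocalStabilityRateOfTermwise`) produces W1-21's letter from a
local domain MATCHING (pure lattice geometry, definer-lane content) and a PER-TERM volume-independence rate instead.  THIS FILE is the package with that substitution made: every analytic
∕ dynamical hypothesis is now a statement about ONE (2.13) term (or one matched pair of terms), and the only non-term rows are W1-20's law (1.7) and the matching — the shape in which NODE A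
∕ N10 (terms) and def-W1 ∕ def-T (geometry) can discharge them separately.

WHAT (`M = L^{m′}`; ONE `(κ, δ₀, r, B₃)`; `δ₁ = delta1 δ₀ κ (4M)`, `C₅′ = (16M₀B₃²∕r²)e^{12Mδ₁}K₀(64,8)K₁(4,δ₀∕2)`, `a′ = max{2κ₀(64,8)+4, −log ω∕(2c_ρ)}`, `r_inc = max{ω^{1∕2}, e^{−ηc′}}`):
★★★ `u3LettersOfRecord₁₃_of_termwiseLocalTermData` — under W1-20's law: (P1) single-run analyticity with (4.35) tails and (1.18) sup decay · (P2′) the matching `φ` (`Set.BijOn` on the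
`R`-local domains for `R ≤ c_ρK`, `K ≥ K_m`) + the per-term rate `A₁ω^K` · (P3) the two-run holomorphic data with the term-level sup bound ⇒
`r_inc < 1 ∧ GeometricIncrementsOfRecord₁₃ … r_inc ∧ PolLimitsExistOfRecord₁₃ … ∧ WindowedStepRateOfRecord₁₃ … 1 δ₁ θ₅ (C₅′θ₅) ∧ KernelStepRateOfRecord₁₃ … δ₁ θ₅ C₅′`.

HONEST FRAMING — what this is NOT.  Count-neutral composition (PART 1 §1b + FILE 4 + g9 FILE 4 v1.1 + g6); NO estimate of Bałaban's proved or asserted — W1-20's law, the analytic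
representations (NODE A ∕ N10), the matching (lattice geometry, definer lane), the per-term volume-independence rate and the TERM-LEVEL TWO-RUN SUP BOUND (node N18's content, NOT PRINTED
for d = 4) are DISPLAYED hypotheses; nothing constructed; no letter OF RECORD inhabited; N18 ∕ N22 ∕ (D4) NOT discharged; K3⁸ OPEN (skeleton v6 untouched), not claimed; counts UNMOVED
(typed 28∕28 · discharged 5∕27 (A 5∕28)); R4 closes the conditional finite-𝕋⁴ rung `BalabanLadder.UV` only — NOT ℝ⁴, NOT infinite volume, NOT OS, NOT a mass gap; the Clay problem is NOT
proved by any of this.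

References (TYPES only): [I] = [Balaban1987RG1] Thm 1 p. 259, (1.7) p. 261, (1.18) p. 263, (1.20)–(1.21) p. 264, (4.35)–(4.37) pp. 290–291, (5.10) p. 293; [II] = [Balaban1988RG2Cluster]
(2.13)–(2.14) pp. 14–15; [King1986] (3.73) p. 665.  Imports PART 1 and FILE 4 BY NAME; nothing re-declared.
-/

noncomputable section

namespace YMDAG.N18.U3LettersPackage

open Filter Metric Set
open scoped BigOperators Topology
open Literature.MathematicalPhysics.QuantumFieldTheory.Balaban1983to89
open Literature.MathematicalPhysics.QuantumFieldTheory.Balaban1983to89.T4Continuum (T4Family)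
open Literature.MathematicalPhysics.QuantumFieldTheory.Balaban1983to89.FlowStep (Box)
open Literature.MathematicalPhysics.QuantumFieldTheory.Balaban1983to89.B12PolarizationTensor120 (polComp expChart)
open Literature.MathematicalPhysics.QuantumFieldTheory.Balaban1983to89.Node00 (Stage13Params polScalar siteOfInt MatA)
open Literature.MathematicalPhysics.QuantumFieldTheory.Balaban1983to89.Node00.U3OfKernels (histPrefix)
open Literature.MathematicalPhysics.QuantumFieldTheory.Balaban1983to89.Node00.U3KernelLetters (PolLimitsExistOfRecord₁₃ GeometricIncrementsOfRecord₁₃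
  WindowedStepRateOfRecord₁₃ KernelStepRateOfRecord₁₃)
open Literature.MathematicalPhysics.QuantumFieldTheory.Balaban1983to89.Node00.LocalizedSum17 (ReadingMaps Localizes17OfRecord₁₃)
open Literature.MathematicalPhysics.QuantumFieldTheory.Balaban1983to89.Node00.Sect2 (domSys domCount)
open Literature.MathematicalPhysics.QuantumFieldTheory.Balaban1983to89.Node00.W1 (ClusterTower castDom domSys_succ)
open Literature.MathematicalPhysics.QuantumFieldTheory.Balaban1983to89.T4LevelShift (siteShift)
open Literature.MathematicalPhysics.QuantumFieldTheory.Balaban1983to89.T4OutputRate (Window)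
open Literature.MathematicalPhysics.QuantumFieldTheory.Balaban1983to89.B12Decay510 (delta1)
open Literature.MathematicalPhysics.QuantumFieldTheory.Balaban1983to89.B12Decay510Window (K₁)
open Literature.MathematicalPhysics.QuantumFieldTheory.Balaban1983to89.B12Decay510Torus (distCT nearT)
open Literature.MathematicalPhysics.QuantumFieldTheory.Balaban1983to89.B12TreeDecay (K₀ kappa₀ kappa₀_nonneg)
open Literature.MathematicalPhysics.QuantumFieldTheory.Balaban1983to89.TreeLengthTorus (TPt torusTreeLen)
open YMDAG.N18.TwoRunWindowLevelShift (ladder)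
open YMDAG.N18.GeometricIncrementsOfLocalTerms (twoScaleRate_lt_one)
open YMDAG.N18.RunDifferenceOfLocalTerms (windowedStepRateOfRecord₁₃_one_of_holomorphicTwoRun)
open YMDAG.N18.PolLimitRate (polLimitsExistOfRecord₁₃_of_geometricIncrements kernelStepRateOfRecord₁₃_of_geometricIncrements_of_windowed)
open YMDAG.N18.LocalStabilityRateOfTermwise (geometricIncrementsOfRecord₁₃_of_termwiseVolumeRate twoScale_c_le)

section Record

open scoped Matrix.Norms.L2Operator

variable {𝔸 : Type*} {Ec : Type*} [NormedAddCommGroup Ec] [NormedSpace ℂ Ec]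
variable (F : T4Family) (N : ℕ) [NeZero N] (m' : ℕ) (M : ℕ) [NeZero M] (hM : M = F.L ^ m')

include hM in
open Classical in
/-- ★★★ **NODE U3's FOUR LETTERS OF RECORD FROM TERM-LEVEL DATA + ONE MATCHING.**  Under W1-20's law `Localizes17OfRecord₁₃ F N θ S emb` (`M = L^{m′}`), ONE `(κ, δ₀, r, B₃)`
(`κ∕4 ≥ κ₀(64,8)`): (P1) per `(g ∈ Window θ.γ, k, K, X)` the (2.13) term's record β-chart is `Re G ∘ ι` — `ι` with the (4.35) tails `B₃e^{−δ₀distCT(cast t, X)}`, `G` holomorphic on an open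
`U ⊇ ball 0 r`, `‖G‖ ≤ E₀e^{−κd(X)}` on the ball; (P2′) a local domain matching `φ k K : 𝐃_{k+1}(T_K) → 𝐃_{k+1}(T_{K+1})` (a `Set.BijOn` between the `R`-local domains for `K ≥ K_m`,
`0 ≤ R ≤ c_ρK` — lattice GEOMETRY, displayed) and the PER-TERM volume-independence rate `|polScalar(term_{K+1}(φX))(z,0) − polScalar(term_K(X))(z,0)| ≤ A₁ω^K` on the `R`-local `X`
(`0 < ω < 1`); (P3) per matched run pair `(K, K+1)`: `G_B, G_A` holomorphic through a COMMON complexification `ιc` with tails, representing both runs' terms, and the TWO-RUN SUP BOUND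
`‖G_B − G_A‖ ≤ M₀θ₅^{k+1}e^{−κd(X)}` (term-level NE5, NOT PRINTED for d = 4).  THEN
`r_inc < 1 ∧ GeometricIncrementsOfRecord₁₃ F N θ r_inc ∧ PolLimitsExistOfRecord₁₃ F N θ ∧ WindowedStepRateOfRecord₁₃ F N θ 1 δ₁ θ₅ (C₅′θ₅) ∧ KernelStepRateOfRecord₁₃ F N θ δ₁ θ₅ C₅′`
(PART 1 §1b ⇒ `hC ∧ hval`; FILE 4 ⇒ `hinc`; g6 ⇒ `hL` and `h18L`; g9 FILE 4 v1.1 ⇒ `hS`).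
[cite: Balaban1987RG1, Thm 1 p.259, (1.7) p.261, (1.18) p.263, (1.20)-(1.21) p.264, (4.35)-(4.36) p.290, (4.37) p.291 and (5.10) p.293; Balaban1988RG2Cluster, (2.13)-(2.14) pp.14-15; King1986, (3.73) p.665] -/
theorem u3LettersOfRecord₁₃_of_termwiseLocalTermData (θ : Stage13Params F N) (S : (K : ℕ) → ClusterTower (F.P K) 𝔸 M) (emb : ReadingMaps F (MatA N) 𝔸)
    (hloc : Localizes17OfRecord₁₃ F N θ S emb) {κ δ₀ ω cρ r E₀ B₃ : ℝ} (hκ0 : 0 < κ) (hδ₀ : 0 < δ₀) (hκ : kappa₀ (4 * 2 ^ 4) (2 * 4) ≤ κ / 2 / 2)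
    (hω : 0 < ω) (hω1 : ω < 1) (hcρ : 0 < cρ) (hr : 0 < r) (hE₀ : 0 ≤ E₀) (hB₃ : 0 ≤ B₃)
    (ι₁ : letI := θ.instVβ₁; letI := θ.instVβ₂
      (g : ℕ → ℝ) → (k K : ℕ) → (domSys (F.P K) M (k + 1)).Dom → ((Fin (F.P K).d → Site (F.P K) (k + 1) → θ.Vβ) →L[ℝ] Ec))
    (G₁ : (g : ℕ → ℝ) → (k K : ℕ) → (domSys (F.P K) M (k + 1)).Dom → Ec → ℂ)
    (U₁ : (g : ℕ → ℝ) → (k K : ℕ) → (domSys (F.P K) M (k + 1)).Dom → Set Ec) (hU₁ : ∀ g k K X, IsOpen (U₁ g k K X))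
    (hG₁ : ∀ g k K X, DifferentiableOn ℂ (G₁ g k K X) (U₁ g k K X)) (hrU₁ : ∀ g k K X, ball (0 : Ec) r ⊆ U₁ g k K X)
    (hf₁ : letI := θ.instVβ₁; letI := θ.instVβ₂
      ∀ g ∈ Window θ.γ, ∀ (k K : ℕ) (X : (domSys (F.P K) M (k + 1)).Dom) (B : Fin (F.P K).d → Site (F.P K) (k + 1) → θ.Vβ),
        expChart (fun W' => (((S K) k).E (histPrefix g k) (emb K k W') X).re) θ.ρ8 B = (G₁ g k K X (ι₁ g k K X B)).re)
    (hsup₁ : ∀ g ∈ Window θ.γ, ∀ (k K : ℕ) (X : (domSys (F.P K) M (k + 1)).Dom), ∀ ζ ∈ ball (0 : Ec) r, ‖G₁ g k K X ζ‖ ≤ E₀ * Real.exp (-κ * torusTreeLen X.1))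
    (htail₁ : letI := θ.instVβ₁; letI := θ.instVβ₂; letI := θ.instιβ
      ∀ (g : ℕ → ℝ) (k K : ℕ) (X : (domSys (F.P K) M (k + 1)).Dom) (l : Fin (F.P K).d) (t : Site (F.P K) (k + 1)) (c : θ.ιβ),
        let e : Site (F.P K) (k + 1) → TPt 4 (domCount (F.P K) M (k + 1) * M) := fun x i => (ZMod.cast (x i) : ZMod (domCount (F.P K) M (k + 1) * M))
        ‖ι₁ g k K X (Pi.single l (Pi.single t (θ.bV c)))‖ ≤ B₃ * Real.exp (-δ₀ * distCT (domCount (F.P K) M (k + 1)) M (e t) (nearT (M := M) (e t) X)))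
    (φ : (k K : ℕ) → (domSys (F.P K) M (k + 1)).Dom → (domSys (F.P (K + 1)) M (k + 1)).Dom)
    (hφ : ∀ k : ℕ, ∃ Km : ℕ, ∀ K, Km ≤ K → ∀ R : ℝ, 0 ≤ R → R ≤ cρ * K →
      Set.BijOn (φ k K)
        ↑(Finset.univ.filter (fun X : (domSys (F.P K) M (k + 1)).Dom =>
          ¬ (R < torusTreeLen X.1 ∨ R < distCT (domCount (F.P K) M (k + 1)) M
            (fun i : Fin 4 => (ZMod.cast (siteOfInt F K (k + 1) 0 i) : ZMod (domCount (F.P K) M (k + 1) * M)))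
            (nearT (M := M) (fun i : Fin 4 => (ZMod.cast (siteOfInt F K (k + 1) 0 i) : ZMod (domCount (F.P K) M (k + 1) * M))) X))))
        ↑(Finset.univ.filter (fun X : (domSys (F.P (K + 1)) M (k + 1)).Dom =>
          ¬ (R < torusTreeLen X.1 ∨ R < distCT (domCount (F.P (K + 1)) M (k + 1)) M
            (fun i : Fin 4 => (ZMod.cast (siteOfInt F (K + 1) (k + 1) 0 i) : ZMod (domCount (F.P (K + 1)) M (k + 1) * M)))
            (nearT (M := M) (fun i : Fin 4 => (ZMod.cast (siteOfInt F (K + 1) (k + 1) 0 i) : ZMod (domCount (F.P (K + 1)) M (k + 1) * M))) X)))))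
    (hterm : letI := θ.instVβ₁; letI := θ.instVβ₂; letI := θ.instιβ
      ∀ g ∈ Window θ.γ, ∀ (k : ℕ) (μ ν : Fin 4) (z : Fin 4 → ℤ), ∃ (Ks : ℕ) (A₁ : ℝ), 0 ≤ A₁ ∧ ∀ K, Ks ≤ K → ∀ R : ℝ, 0 ≤ R → R ≤ cρ * K →
        ∀ X ∈ Finset.univ.filter (fun X : (domSys (F.P K) M (k + 1)).Dom =>
            ¬ (R < torusTreeLen X.1 ∨ R < distCT (domCount (F.P K) M (k + 1)) M
              (fun i : Fin 4 => (ZMod.cast (siteOfInt F K (k + 1) 0 i) : ZMod (domCount (F.P K) M (k + 1) * M)))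
              (nearT (M := M) (fun i : Fin 4 => (ZMod.cast (siteOfInt F K (k + 1) 0 i) : ZMod (domCount (F.P K) M (k + 1) * M))) X))),
          |polScalar (fun W' => (((S (K + 1)) k).E (histPrefix g k) (emb (K + 1) k W') (φ k K X)).re) θ.ρ8 θ.bV (Fin.cast (F.P_d (K + 1)).symm μ)
              (siteOfInt F (K + 1) (k + 1) z) (Fin.cast (F.P_d (K + 1)).symm ν) (siteOfInt F (K + 1) (k + 1) 0) -
            polScalar (fun W' => (((S K) k).E (histPrefix g k) (emb K k W') X).re) θ.ρ8 θ.bV (Fin.cast (F.P_d K).symm μ) (siteOfInt F K (k + 1) z)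
              (Fin.cast (F.P_d K).symm ν) (siteOfInt F K (k + 1) 0)| ≤ A₁ * ω ^ K)
    {θ₅ M₀ : ℝ} (hθ₅ : 0 ≤ θ₅) (hM₀ : 0 ≤ M₀)
    (ιc : letI := θ.instVβ₁; letI := θ.instVβ₂
      (k : ℕ) → (Fin (k + 2) → ℝ) → (K : ℕ) → (domSys (F.P (K + 1)) M (k + 1 + 1)).Dom → ((Fin (F.P (K + 1)).d → Site (F.P (K + 1)) (k + 1 + 1) → θ.Vβ) →L[ℝ] Ec))
    (GB GA : (k : ℕ) → (Fin (k + 2) → ℝ) → (K : ℕ) → (domSys (F.P (K + 1)) M (k + 1 + 1)).Dom → Ec → ℂ)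
    (U : (k : ℕ) → (Fin (k + 2) → ℝ) → (K : ℕ) → (domSys (F.P (K + 1)) M (k + 1 + 1)).Dom → Set Ec) (hU : ∀ k w K X, IsOpen (U k w K X))
    (hGB : ∀ k w K X, DifferentiableOn ℂ (GB k w K X) (U k w K X)) (hGA : ∀ k w K X, DifferentiableOn ℂ (GA k w K X) (U k w K X))
    (hrU : ∀ k w K X, ball (0 : Ec) r ⊆ U k w K X)
    (hfB : letI := θ.instVβ₁; letI := θ.instVβ₂
      ∀ (k : ℕ) (w : Fin (k + 2) → ℝ), w ∈ Box θ.γ (k + 1) → ∀ (K : ℕ) (X : (domSys (F.P (K + 1)) M (k + 1 + 1)).Dom) (B),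
        expChart (fun W' => (((S (K + 1)) (k + 1)).E w (emb (K + 1) (k + 1) W') X).re) θ.ρ8 B = (GB k w K X (ιc k w K X B)).re)
    (hfA : letI := θ.instVβ₁; letI := θ.instVβ₂
      ∀ (k : ℕ) (w : Fin (k + 2) → ℝ), w ∈ Box θ.γ (k + 1) → ∀ (K : ℕ) (X : (domSys (F.P (K + 1)) M (k + 1 + 1)).Dom) (B),
        expChart (fun W' : Fin (F.P (K + 1)).d → Site (F.P (K + 1)) (k + 1 + 1) → MatA N =>
          (((S K) k).E (Fin.tail w) (emb K k (fun κ' y => W' κ' (siteShift (ladder F K k) y))) (castDom (domSys_succ F M K (k + 1)) X)).re) θ.ρ8 B =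
          (GA k w K X (ιc k w K X B)).re)
    (hsup : ∀ (k : ℕ) (w : Fin (k + 2) → ℝ), w ∈ Box θ.γ (k + 1) → ∀ (K : ℕ) (X : (domSys (F.P (K + 1)) M (k + 1 + 1)).Dom), ∀ ζ ∈ ball (0 : Ec) r,
      ‖GB k w K X ζ - GA k w K X ζ‖ ≤ M₀ * θ₅ ^ (k + 1) * Real.exp (-κ * torusTreeLen X.1))
    (htail : letI := θ.instVβ₁; letI := θ.instVβ₂; letI := θ.instιβ
      ∀ (k : ℕ) (w : Fin (k + 2) → ℝ) (K : ℕ) (X : (domSys (F.P (K + 1)) M (k + 1 + 1)).Dom) (l : Fin (F.P (K + 1)).d) (t : Site (F.P (K + 1)) (k + 1 + 1)) (c : θ.ιβ),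
        let e : Site (F.P (K + 1)) (k + 1 + 1) → TPt 4 (domCount (F.P (K + 1)) M (k + 1 + 1) * M) :=
          fun x i => (ZMod.cast (x i) : ZMod (domCount (F.P (K + 1)) M (k + 1 + 1) * M))
        ‖ιc k w K X (Pi.single l (Pi.single t (θ.bV c)))‖ ≤ B₃ * Real.exp (-δ₀ * distCT (domCount (F.P (K + 1)) M (k + 1 + 1)) M (e t) (nearT (M := M) (e t) X))) :
    max (Real.exp (Real.log ω / 2))
        (Real.exp (-(min κ δ₀ / 2) * (-Real.log ω / (2 * (max (2 * kappa₀ (4 * 2 ^ 4) (2 * 4) + 4) (-Real.log ω / (2 * cρ)) + 1))))) < 1 ∧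
    GeometricIncrementsOfRecord₁₃ F N θ (max (Real.exp (Real.log ω / 2))
        (Real.exp (-(min κ δ₀ / 2) * (-Real.log ω / (2 * (max (2 * kappa₀ (4 * 2 ^ 4) (2 * 4) + 4) (-Real.log ω / (2 * cρ)) + 1)))))) ∧
    PolLimitsExistOfRecord₁₃ F N θ ∧
    WindowedStepRateOfRecord₁₃ F N θ 1 (delta1 δ₀ κ ((M : ℝ) * 4)) θ₅
      (16 * M₀ * B₃ ^ 2 / r ^ 2 * Real.exp (delta1 δ₀ κ ((M : ℝ) * 4) * ((M : ℝ) * 4) * 3) * K₀ (4 * 2 ^ 4) (2 * 4) * K₁ 4 (δ₀ / 2) * θ₅) ∧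
    KernelStepRateOfRecord₁₃ F N θ (delta1 δ₀ κ ((M : ℝ) * 4)) θ₅
      (16 * M₀ * B₃ ^ 2 / r ^ 2 * Real.exp (delta1 δ₀ κ ((M : ℝ) * 4) * ((M : ℝ) * 4) * 3) * K₀ (4 * 2 ^ 4) (2 * 4) * K₁ 4 (δ₀ / 2)) := by
  letI := θ.instVβ₁; letI := θ.instVβ₂; letI := θ.instιβ
  obtain ⟨hC, hval⟩ := chartData_localizedSum_of_holomorphicValue F M S emb θ.ρ8 θ.bV (Window θ.γ) hr hE₀ ι₁ G₁ U₁ hU₁ hG₁ hrU₁ hf₁ hsup₁ htail₁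
  have hinc := geometricIncrementsOfRecord₁₃_of_termwiseVolumeRate F N m' M hM θ S emb hloc hκ0 hδ₀ hκ hω hω1 hcρ hC hval φ hφ hterm
  have hk0 : 0 ≤ kappa₀ (4 * 2 ^ 4) (2 * 4) := kappa₀_nonneg (by norm_num) _
  have ha'0 : 0 ≤ max (2 * kappa₀ (4 * 2 ^ 4) (2 * 4) + 4) (-Real.log ω / (2 * cρ)) := le_max_of_le_left (by positivity)
  have hη : 0 < min κ δ₀ / 2 := by have := lt_min hκ0 hδ₀; linarith
  have hrr := twoScaleRate_lt_one hη ha'0 hω hω1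
  have hκ2 : kappa₀ (4 * 2 ^ 4) (2 * 4) ≤ κ / 2 := hκ.trans (by linarith)
  have hS := windowedStepRateOfRecord₁₃_one_of_holomorphicTwoRun F N m' M hM θ S emb hloc hθ₅ hr hM₀ hB₃ hδ₀ hκ2 ιc GB GA U hU hGB hGA hrU hfB hfA hsup htail
  exact ⟨hrr, hinc, polLimitsExistOfRecord₁₃_of_geometricIncrements F N θ hrr hinc, hS,
    kernelStepRateOfRecord₁₃_of_geometricIncrements_of_windowed F N θ 1 hrr hinc hS⟩

end Record

end YMDAG.N18.U3LettersPackage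

end
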